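import Summits.BirchSwinnertonDyer.BirchSwinnertonDyer.Theorems.AdditiveKolyvaginRoadLagrangianSwitchAtP
import HarnessLib

/-!
# Route `AdditiveKolyvaginRoad`, crux KS′ `LevelKolyvaginSystemsAdditive` (stmt-BirchSwinnertonDyer-21396) ∕ KPA′ (stmt-BirchSwinnertonDyer-21400):
# the one-place Lagrangian switch, part 7 — a GENERAL BASE: Selmer groups of a structure updated at one place, Poitou–Tate reciprocity for a
# structure isotropic off the place, isotropic lines in a plane are Lagrangian, and the JUMP `[relaxed : strict]² = #H¹(K_{w₀}, E[p])` for a base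
# that is Kummer off a finite set `U` and Lagrangian on `U`
# (cell `pub/bsd-wall`, width seat `bsd-wall-akr-p2x-w3` g10; `--supports stmt-BirchSwinnertonDyer-21396`, helper; E-side glue; sequel of
# `…LagrangianSwitchAtP{Jump,Lines,}.lean` (akr-p2x-w2 g3) and of this seat's `…Switched{Iso,RankLowering,LevelDescent,Eigen,Bridge}.lean`)

WHY. The landed switch `natCard_selmerGroup_switch` compares `H¹_𝓚` with `H¹_{𝓚[w₀ ↦ L]}` — its BASE is E's Kummer structure `𝓚`. The parity leg of
the «FL-engine» (crux card `irred-vertex-anchor`, T2; this seat's switched level descent `exists_level_switched_eq_bot_at_p` + eigen-sum + bridge)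
needs TWO switches, at the two places `𝔭 ≠ 𝔭̄` above the split `p`: the second one has base `𝓚[𝔭 ↦ L]`, which is Kummer only off `𝔭` and a
Lagrangian LINE at `𝔭`. This file re-proves the inputs of the switch for such a base — any structure `𝓑` equal to `𝓚` off a finite set `U` of finite
places and Lagrangian (`annRight = self`) on `U` —; the sequel `…LagrangianSwitchAtPDouble.lean` runs the switch on it and composes two switches.

WHAT (namespace `…Theorems.AdditiveKoly.LagrangianSwitchAtP`; `W` an elliptic curve over a number field `K`).
* §1 `selmerGroup_update_eq_of_base` (`H¹_{𝓑[v₀ ↦ D]} = H¹_{𝓑[v₀ ↦ ⊤]} ⊓ loc⁻¹ D`), `selmerGroup_update_bot_eq_of_base`, `selmerGroup_update_bot_le_of_base`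
  — any base structure (the base-general forms of `selmerGroup_update_eq` ∕ `selmerGroup_kummerStrict_eq`).
* §2 `invWeilPairing_localization_eq_zero_of_mem_update_top` — Poitou–Tate reciprocity: if `𝓑` is ISOTROPIC at every place `≠ v₀`, the image at
  `v₀` of `H¹_{𝓑[v₀ ↦ ⊤]}` is isotropic (`sum_inv_weilCupProduct_localization_eq_zero`).
* §3 `natCard_eq_and_annRight_eq_of_isotropic` — in a PLANE (`#H¹(K_w, E[p]) = p²`), a non-zero isotropic subgroup has order `p` AND is its own
  annihilator (Lagrangian): the count block of the landed switch, factored, plus `#annRight(L) · #L = p²`.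
* §4 **`relIndex_update_bot_top_sq_of_base`** — THE JUMP for a general base: `[H¹_{𝓑[w₀ ↦ ⊤]} : H¹_{𝓑[w₀ ↦ 0]}]² = #H¹(K_{w₀}, E[p])`, from the jump
  file's `relIndex_sq_eq_of_lagrangian` with the exceptional set «above `p`, bad, `w₀`, `U`» (unramifiedness off it from
  `kummerStrict_isUnramifiedOutside`; finiteness inside `kummerOutside`; Lagrangian off `w₀`: `annRight_kummer_eq_of_odd` off `U`, hypothesis on `U`).

HONEST FRAMING: theorems only; 0 definitions, 0 named facts, 0 `sorry`; standard axioms; CONDITIONAL on the displayed Poitou–Tate family `inv`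
(`IsPerfect`, `SumLocalTermEqZero`, `SelmerComplement` — the content of the tree THEOREM `poitouTate_selmerStructure_duality_holds`, discharged in the
sequel's packaged statements) and the displayed hypotheses on `𝓑`. E-side glue; closes nothing. BSD is not proved by any of this.

References: [cite: MilneADT2006, Ch. I, Cor. 2.3, Thm. 2.8, Thm. 4.10, Lemma 6.15] [cite: Howard2004HeegnerKolyvagin, Def. 2.1.10, Thm. 2.1.11]
[cite: PoonenRains2012, Prop. 4.10, Prop. 4.11].
-/

-- single-conjunct summit: `Summit.BirchSwinnertonDyer.BirchSwinnertonDyer.…` repeats the name by design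
set_option linter.dupNamespace false

noncomputable section

open scoped Classical NumberField
open Function NumberField IsDedekindDomain Field WeierstrassCurve
open Literature.NumberTheory.EllipticCurves
open Literature.NumberTheory.GaloisRepresentations Literature.NumberTheory.GaloisRepresentations.DiscreteGaloisModule
  Literature.NumberTheory.GaloisCohomology
open Summit.BirchSwinnertonDyer.Rank1Residual.X11b.FiniteDuality
open Summit.BirchSwinnertonDyer.Rank1Residual.X11b.Relaxation
open Summit.BirchSwinnertonDyer.Rank1Residual.X11b.LocBridge
open Summit.BirchSwinnertonDyer.Rank1Residual.X11b
open Summit.BirchSwinnertonDyer.Rank1Residual.GaloisImage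
open Summit.BirchSwinnertonDyer.Rank1Residual.X11b.Three.Koly.ZhangSupply
open Summit.BirchSwinnertonDyer.Rank1Residual.X11b.KummerPT

namespace Summit.BirchSwinnertonDyer.BirchSwinnertonDyer.Theorems.AdditiveKoly.LagrangianSwitchAtP

variable {K : Type} [Field K] [NumberField K] (W : WeierstrassCurve K) [W.IsElliptic]

/-! ## §1 Selmer groups of a structure updated at one place: cuts of the relaxed group (any base structure) -/

section Update

variable (n : ℕ)

omit [W.IsElliptic] in
/-- **`H¹_{𝓑[v₀ ↦ D]} = H¹_{𝓑[v₀ ↦ ⊤]} ⊓ loc_{v₀}⁻¹ D`** for ANY Selmer structure `𝓑` (the base-general form of `selmerGroup_update_eq`).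
[folklore] -/
theorem selmerGroup_update_eq_of_base (𝓑 : SelmerStructure (W.torsionGaloisModule (n : ℤ))) (v₀ : Place K)
    (D : AddSubgroup (galoisCohomology ((W.torsionGaloisModule (n : ℤ)).toLocal v₀) 1)) :
    SelmerStructure.selmerGroup (Function.update 𝓑 v₀ D) =
      SelmerStructure.selmerGroup (Function.update 𝓑 v₀ ⊤) ⊓
        D.comap (galoisCohomology.localization (W.torsionGaloisModule (n : ℤ)) v₀ 1) := by
  ext x
  simp only [AddSubgroup.mem_inf, AddSubgroup.mem_comap, SelmerStructure.mem_selmerGroup_iff]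
  constructor
  · intro h
    refine ⟨fun v ↦ ?_, ?_⟩
    · by_cases hv : v = v₀
      · subst hv; rw [Function.update_self]; exact AddSubgroup.mem_top _
      · rw [Function.update_of_ne hv]
        have h' := h v
        rwa [Function.update_of_ne hv] at h'
    · have h' := h v₀
      rwa [Function.update_self] at h'
  · rintro ⟨h, hD⟩ v
    by_cases hv : v = v₀
    · subst hv; rwa [Function.update_self]
    · rw [Function.update_of_ne hv]
      have h' := h v
      rwa [Function.update_of_ne hv] at h'

omit [W.IsElliptic] in
/-- `H¹_{𝓑[v₀ ↦ ⊥]} = H¹_{𝓑[v₀ ↦ ⊤]} ⊓ ker loc_{v₀}` for any base structure `𝓑`. [folklore] -/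
theorem selmerGroup_update_bot_eq_of_base (𝓑 : SelmerStructure (W.torsionGaloisModule (n : ℤ))) (v₀ : Place K) :
    SelmerStructure.selmerGroup (Function.update 𝓑 v₀ ⊥) =
      SelmerStructure.selmerGroup (Function.update 𝓑 v₀ ⊤) ⊓
        (galoisCohomology.localization (W.torsionGaloisModule (n : ℤ)) v₀ 1).ker := by
  rw [selmerGroup_update_eq_of_base W n 𝓑 v₀ ⊥]
  congr 1

omit [W.IsElliptic] in
/-- `H¹_{𝓑[v₀ ↦ ⊥]} ≤ H¹_{𝓑[v₀ ↦ ⊤]}`. [folklore] -/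
theorem selmerGroup_update_bot_le_of_base (𝓑 : SelmerStructure (W.torsionGaloisModule (n : ℤ))) (v₀ : Place K) :
    SelmerStructure.selmerGroup (Function.update 𝓑 v₀ (⊥ : AddSubgroup _)) ≤
      SelmerStructure.selmerGroup (Function.update 𝓑 v₀ ⊤) := by
  rw [selmerGroup_update_bot_eq_of_base W n 𝓑 v₀]
  exact inf_le_left

end Update

/-! ## §2 Poitou–Tate reciprocity for the relaxed group of a base structure isotropic off `v₀` -/

section Reciprocity

variable (n : ℕ) [NeZero n]
variable (e : W.geomTorsion (n : ℤ) → W.geomTorsion (n : ℤ) → AlgebraicClosure K)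
  (hμ : ∀ S T, e S T ^ n = 1)
  (hadd₁ : ∀ S₁ S₂ T, e (S₁ + S₂) T = e S₁ T * e S₂ T)
  (hadd₂ : ∀ S T₁ T₂, e S (T₁ + T₂) = e S T₁ * e S T₂)
  (hgal : ∀ (σ : absoluteGaloisGroup K) (S T : W.geomTorsion (n : ℤ)), σ • e S T = e (σ • S) (σ • T))
  (inv : LocalInvariants K n)

/-- **The image at `v₀` of the `v₀`-relaxed Selmer group of a structure ISOTROPIC off `v₀` is isotropic** (Poitou–Tate reciprocity:
all other local terms vanish by hypothesis). Base-general form of `invWeilPairing_localization_eq_zero_of_mem_relaxed`.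
[cite: MilneADT2006, Ch. I, Thm. 4.10(b)] -/
theorem invWeilPairing_localization_eq_zero_of_mem_update_top
    [∀ v : Place K, CompactSpace (absoluteGaloisGroup (Place.Completion v))] [Finite (W.geomTorsion n)]
    (hPT : inv.SumLocalTermEqZero) (𝓑 : SelmerStructure (W.torsionGaloisModule (n : ℤ))) (v₀ : Place K)
    (h𝓑iso : ∀ v : Place K, v ≠ v₀ → ∀ a ∈ 𝓑 v, ∀ b ∈ 𝓑 v, invWeilPairing W n e hμ hadd₁ hadd₂ hgal inv v a b = 0)
    {x y : galoisCohomology (W.torsionGaloisModule n) 1}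
    (hx : x ∈ SelmerStructure.selmerGroup (Function.update 𝓑 v₀ ⊤))
    (hy : y ∈ SelmerStructure.selmerGroup (Function.update 𝓑 v₀ ⊤)) :
    invWeilPairing W n e hμ hadd₁ hadd₂ hgal inv v₀
      (galoisCohomology.localization (W.torsionGaloisModule n) v₀ 1 x)
      (galoisCohomology.localization (W.torsionGaloisModule n) v₀ 1 y) = 0 := by
  rw [SelmerStructure.mem_selmerGroup_iff] at hx hy
  have hS : ∀ v ∉ ({v₀} : Finset (Place K)), inv v ((weilContPairingLocal W n e hμ hadd₁ hadd₂ hgal v).cupProduct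
      (galoisCohomology.localization (W.torsionGaloisModule n) v 1 x)
      (galoisCohomology.localization (W.torsionGaloisModule n) v 1 y)) = 0 := by
    intro v hv
    have hne : v ≠ v₀ := fun h ↦ hv (h ▸ Finset.mem_singleton_self _)
    have hxv := hx v
    have hyv := hy v
    rw [Function.update_of_ne hne] at hxv hyv
    have h := h𝓑iso v hne _ hxv _ hyv
    rwa [invWeilPairing_apply] at h
  have h := sum_inv_weilCupProduct_localization_eq_zero W n e hμ hadd₁ hadd₂ hgal inv hPT x y {v₀} hS
  rwa [Finset.sum_singleton, ← invWeilPairing_apply] at h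

end Reciprocity

/-! ## §3 Isotropic lines in a plane: order `p` and Lagrangian -/

section Lines

variable (p : ℕ) [Fact p.Prime]
variable (e : W.geomTorsion ((p ^ 1 : ℕ) : ℤ) → W.geomTorsion ((p ^ 1 : ℕ) : ℤ) → AlgebraicClosure K)
  (hμ : ∀ S T, e S T ^ (p ^ 1) = 1)
  (hadd₁ : ∀ S₁ S₂ T, e (S₁ + S₂) T = e S₁ T * e S₂ T)
  (hadd₂ : ∀ S T₁ T₂, e S (T₁ + T₂) = e S T₁ * e S T₂)
  (hgal : ∀ (σ : absoluteGaloisGroup K) (S T : W.geomTorsion ((p ^ 1 : ℕ) : ℤ)), σ • e S T = e (σ • S) (σ • T))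
  (halt : ∀ T, e T T = 1) (hnondeg : ∀ T, (∀ S, e S T = 1) → T = 0)
  (inv : LocalInvariants K (p ^ 1))

include halt hnondeg in
/-- **A non-zero isotropic subgroup of a PLANE is a LAGRANGIAN line**: at a finite place `w` with `#H¹(K_w, E[p]) = p²`, for a perfect family
`inv` and a Weil pairing `e`, a subgroup `L ≠ 0` isotropic for `inv_w(· ∪ₑ ·)` has order `p` and is its own annihilator. (The count half is the
block `hLcard` of `natCard_selmerGroup_switch`, factored; the Lagrangian half follows from `#annRight(L) · #L = p²`.)
[cite: MilneADT2006, Ch. I, Cor. 2.3] [cite: PoonenRains2012, Prop. 4.10] -/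
theorem natCard_eq_and_annRight_eq_of_isotropic
    [∀ v : Place K, CompactSpace (absoluteGaloisGroup (Place.Completion v))] [Finite (W.geomTorsion ((p ^ 1 : ℕ) : ℤ))]
    (hperf : inv.IsPerfect) (w : HeightOneSpectrum (𝓞 K))
    (hH : Nat.card (galoisCohomology ((W.torsionGaloisModule ((p ^ 1 : ℕ) : ℤ)).toLocal (Sum.inr w : Place K)) 1) = p ^ 2)
    (L : AddSubgroup (galoisCohomology ((W.torsionGaloisModule ((p ^ 1 : ℕ) : ℤ)).toLocal (Sum.inr w : Place K)) 1))
    (hLiso : ∀ x ∈ L, ∀ y ∈ L, invWeilPairing W (p ^ 1) e hμ hadd₁ hadd₂ hgal inv (Sum.inr w) x y = 0) (hL0 : L ≠ ⊥) :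
    Nat.card L = p ∧ annRight (invWeilPairing W (p ^ 1) e hμ hadd₁ hadd₂ hgal inv (Sum.inr w)) L = L := by
  have hp : p.Prime := Fact.out
  haveI : NeZero (p ^ 1 : ℕ) := ⟨pow_ne_zero 1 hp.ne_zero⟩
  haveI hfinH : Finite (galoisCohomology ((W.torsionGaloisModule ((p ^ 1 : ℕ) : ℤ)).toLocal (Sum.inr w : Place K)) 1) :=
    Nat.finite_of_card_ne_zero (by rw [hH]; exact pow_ne_zero 2 hp.ne_zero)
  have hA : ∀ x : galoisCohomology ((W.torsionGaloisModule ((p ^ 1 : ℕ) : ℤ)).toLocal (Sum.inr w : Place K)) 1,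
      (p ^ 1) • x = 0 :=
    nsmul_continuousCohomology_one_eq_zero _ (p ^ 1)
      (fun T : W.geomTorsion ((p ^ 1 : ℕ) : ℤ) ↦ AddSubgroup.torsionBy.nsmul T)
  have hsymm : ∀ x y, invWeilPairing W (p ^ 1) e hμ hadd₁ hadd₂ hgal inv (Sum.inr w) x y =
      invWeilPairing W (p ^ 1) e hμ hadd₁ hadd₂ hgal inv (Sum.inr w) y x :=
    fun x y ↦ invWeilPairing_symm W (p ^ 1) e hμ hadd₁ hadd₂ hgal halt inv _ x y
  have hbij : Bijective (invWeilPairing W (p ^ 1) e hμ hadd₁ hadd₂ hgal inv (Sum.inr w)) :=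
    invWeilPairing_bijective W (p ^ 1) e hμ hadd₁ hadd₂ hgal hnondeg inv w (hperf w).1.1
  have hflip : Bijective (invWeilPairing W (p ^ 1) e hμ hadd₁ hadd₂ hgal inv (Sum.inr w)).flip := by
    have h : (invWeilPairing W (p ^ 1) e hμ hadd₁ hadd₂ hgal inv (Sum.inr w)).flip =
        invWeilPairing W (p ^ 1) e hμ hadd₁ hadd₂ hgal inv (Sum.inr w) := by
      ext x y
      exact hsymm y x
    rw [h]
    exact hbij
  have hLle : L ≤ annRight (invWeilPairing W (p ^ 1) e hμ hadd₁ hadd₂ hgal inv (Sum.inr w)) L :=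
    fun y hy x hx ↦ hLiso x hx y hy
  have h := natCard_annRight_mul hA _ hflip L
  rw [hH] at h
  have hdvd : Nat.card L ∣ p ^ 2 := hH ▸ AddSubgroup.card_addSubgroup_dvd_card L
  obtain ⟨i, hi, hci⟩ := (Nat.dvd_prime_pow hp).mp hdvd
  have hLcard : Nat.card L = p := by
    interval_cases i
    · rw [pow_zero] at hci
      exact absurd (AddSubgroup.card_eq_one.mp hci) hL0
    · exact hci.trans (pow_one p)
    · exfalso
      have hle' : Nat.card L ≤ Nat.card (annRight (invWeilPairing W (p ^ 1) e hμ hadd₁ hadd₂ hgal inv (Sum.inr w)) L) :=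
        AddSubgroup.card_le_of_le hLle
      rw [hci] at h hle'
      have h1 : Nat.card (annRight (invWeilPairing W (p ^ 1) e hμ hadd₁ hadd₂ hgal inv (Sum.inr w)) L) = 1 :=
        Nat.eq_of_mul_eq_mul_right (pow_pos hp.pos 2) (h.trans (one_mul _).symm)
      rw [h1] at hle'
      have h2 : 1 < p ^ 2 := Nat.one_lt_pow two_ne_zero hp.one_lt
      omega
  refine ⟨hLcard, ?_⟩
  -- `#annRight(L) · p = p²`, so `#annRight(L) = p = #L` and `L ≤ annRight(L)`
  rw [hLcard, sq] at h
  have hann : Nat.card (annRight (invWeilPairing W (p ^ 1) e hμ hadd₁ hadd₂ hgal inv (Sum.inr w)) L) = p :=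
    Nat.eq_of_mul_eq_mul_right hp.pos h
  exact (AddSubgroup.eq_of_le_of_card_ge hLle (by rw [hann, hLcard])).symm

end Lines

/-! ## §4 The JUMP `[relaxed : strict]² = #H¹(K_{w₀}, E[p])` for a base structure that is Kummer off `U` and Lagrangian on `U` -/

section Jump

variable (p : ℕ) [Fact p.Prime]
variable (e : W.geomTorsion ((p ^ 1 : ℕ) : ℤ) → W.geomTorsion ((p ^ 1 : ℕ) : ℤ) → AlgebraicClosure K)
  (hμ : ∀ S T, e S T ^ (p ^ 1) = 1)
  (hadd₁ : ∀ S₁ S₂ T, e (S₁ + S₂) T = e S₁ T * e S₂ T)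
  (hadd₂ : ∀ S T₁ T₂, e S (T₁ + T₂) = e S T₁ * e S T₂)
  (hgal : ∀ (σ : absoluteGaloisGroup K) (S T : W.geomTorsion ((p ^ 1 : ℕ) : ℤ)), σ • e S T = e (σ • S) (σ • T))
  (halt : ∀ T, e T T = 1) (hnondeg : ∀ T, (∀ S, e S T = 1) → T = 0)
  (inv : LocalInvariants K (p ^ 1))

include halt hnondeg in
/-- **THE JUMP for a general base.** `E = W` over any number field `K`, `p ≠ 2`, a Weil pairing `e`, a Poitou–Tate family `inv`; a base Selmer
structure `𝓑` on `E[p]` equal to E's Kummer structure `𝓚` at every place not above the finite set `U` of finite places and LAGRANGIAN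
(`annRight = self` for `inv_u(· ∪ₑ ·)`) at the places of `U`; `w₀` any finite place. Then `[H¹_{𝓑[w₀ ↦ ⊤]} : H¹_{𝓑[w₀ ↦ 0]}]² = #H¹(K_{w₀}, E[p])`
— `relIndex_sq_eq_of_lagrangian` (jump file §3) with the exceptional set «above `p`, bad, `w₀`, `U`»; `U = ∅` is
`relIndex_kummerStrict_kummerRelaxed_sq`. [cite: MilneADT2006, Ch. I, Thm. 4.10] [cite: Howard2004HeegnerKolyvagin, Thm. 2.1.11] -/
theorem relIndex_update_bot_top_sq_of_base
    [∀ v : Place K, CompactSpace (absoluteGaloisGroup (Place.Completion v))] [Finite (W.geomTorsion ((p ^ 1 : ℕ) : ℤ))]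
    (hp2 : p ≠ 2) (hperf : inv.IsPerfect) (hsum : inv.SumLocalTermEqZero) (hcompl : inv.SelmerComplement)
    (𝓑 : SelmerStructure (W.torsionGaloisModule ((p ^ 1 : ℕ) : ℤ))) (U : Finset (HeightOneSpectrum (𝓞 K)))
    (h𝓑K : ∀ v : Place K, (∀ u ∈ U, v ≠ Sum.inr u) → 𝓑 v = W.kummerSelmerStructure ((p ^ 1 : ℕ) : ℤ) v)
    (h𝓑lag : ∀ u ∈ U, annRight (invWeilPairing W (p ^ 1) e hμ hadd₁ hadd₂ hgal inv (Sum.inr u)) (𝓑 (Sum.inr u)) =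
      𝓑 (Sum.inr u))
    (w₀ : HeightOneSpectrum (𝓞 K)) :
    ((SelmerStructure.selmerGroup (Function.update 𝓑 (Sum.inr w₀ : Place K) (⊥ : AddSubgroup _))).relIndex
        (SelmerStructure.selmerGroup (Function.update 𝓑 (Sum.inr w₀ : Place K) ⊤))) ^ 2 =
      Nat.card (galoisCohomology ((W.torsionGaloisModule ((p ^ 1 : ℕ) : ℤ)).toLocal (Sum.inr w₀ : Place K)) 1) := by
  have hp : p.Prime := Fact.out
  haveI : NeZero (p ^ 1 : ℕ) := ⟨pow_ne_zero 1 hp.ne_zero⟩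
  have hp1 : IsPrimePow (p ^ 1 : ℕ) := hp.isPrimePow.pow one_ne_zero
  have hodd : Odd (p ^ 1 : ℕ) := (hp.odd_of_ne_two hp2).pow
  set 𝓕 : SelmerStructure (W.torsionGaloisModule ((p ^ 1 : ℕ) : ℤ)) :=
    Function.update 𝓑 (Sum.inr w₀ : Place K) (⊥ : AddSubgroup _) with h𝓕
  set 𝓖 : SelmerStructure (W.torsionGaloisModule ((p ^ 1 : ℕ) : ℤ)) :=
    Function.update 𝓑 (Sum.inr w₀ : Place K) ⊤ with h𝓖
  -- the exceptional finite set `T'` of finite places: above `p`, bad, `w₀`, `U`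
  have hp0 : (Ideal.span {((p : ℕ) : 𝓞 K)} : Ideal (𝓞 K)) ≠ 0 := by
    rw [Ne, Ideal.zero_eq_bot, Ideal.span_singleton_eq_bot]
    exact_mod_cast hp.ne_zero
  have hpfin : {v : HeightOneSpectrum (𝓞 K) | ((p : ℕ) : 𝓞 K) ∈ v.asIdeal}.Finite :=
    (Ideal.finite_factors hp0).subset fun v hv ↦ (Ideal.dvd_span_singleton).mpr hv
  have hbadfin : {v : HeightOneSpectrum (𝓞 K) | ¬ W.HasGoodReductionAt v}.Finite := by
    have h := W.eventually_hasGoodReductionAt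
    rwa [Filter.eventually_cofinite] at h
  set T' : Finset (HeightOneSpectrum (𝓞 K)) := hpfin.toFinset ∪ hbadfin.toFinset ∪ {w₀} ∪ U with hT'
  have hpT' : ∀ v : HeightOneSpectrum (𝓞 K), ((p : ℕ) : 𝓞 K) ∈ v.asIdeal → v ∈ T' := fun v hv ↦ by
    apply Finset.mem_union_left; apply Finset.mem_union_left; apply Finset.mem_union_left
    exact hpfin.mem_toFinset.mpr hv
  have hbadT' : ∀ v : HeightOneSpectrum (𝓞 K), ¬ W.HasGoodReductionAt v → v ∈ T' := fun v hv ↦ by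
    apply Finset.mem_union_left; apply Finset.mem_union_left; apply Finset.mem_union_right
    exact hbadfin.mem_toFinset.mpr hv
  have hwT' : w₀ ∈ T' := Finset.mem_union_left _ (Finset.mem_union_right _ (Finset.mem_singleton_self _))
  have hUT' : ∀ u ∈ U, u ∈ T' := fun u hu ↦ Finset.mem_union_right _ hu
  have houtp : ∀ v : HeightOneSpectrum (𝓞 K), v ∉ T' → ((p : ℕ) : 𝓞 K) ∉ v.asIdeal := fun v hv h ↦ hv (hpT' v h)
  have houtgood : ∀ v : HeightOneSpectrum (𝓞 K), v ∉ T' → W.HasGoodReductionAt v := fun v hv ↦ by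
    by_contra h
    exact hv (hbadT' v h)
  -- the side conditions of the Poitou–Tate engine
  have hS : ∀ v : HeightOneSpectrum (𝓞 K), v ∉ T' → (((p ^ 1 : ℕ) : ℕ) : 𝓞 K) ∉ v.asIdeal ∧
      GaloisRep.IsUnramifiedAt v (W.torsionGaloisModule ((p ^ 1 : ℕ) : ℤ)) := by
    intro v hv
    have h1 : ((p ^ 1 : ℕ) : 𝓞 K) ∉ v.asIdeal := by
      rw [pow_one]
      exact houtp v hv
    exact ⟨h1, AcSelmer.isUnramifiedAt_torsionGaloisModule W (houtgood v hv)
      (n := ((p ^ 1 : ℕ) : ℤ)) (by rw [Int.cast_natCast]; exact h1)⟩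
  have hinfT : ∀ w : InfinitePlace K, (Sum.inl w : Place K) ∈ finSupport T' := fun w ↦ inl_mem_finSupport T' w
  have hpT : ∀ v : HeightOneSpectrum (𝓞 K), ((p : ℕ) : 𝓞 K) ∈ v.asIdeal → (Sum.inr v : Place K) ∈ finSupport T' :=
    fun v hv ↦ (inr_mem_finSupport_iff T' v).mpr (hpT' v hv)
  have hbadT : ∀ v : HeightOneSpectrum (𝓞 K), ¬ W.HasGoodReductionAt v → (Sum.inr v : Place K) ∈ finSupport T' :=
    fun v hv ↦ (inr_mem_finSupport_iff T' v).mpr (hbadT' v hv)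
  -- the Kummer structure is unramified outside `T'`
  have hKunr : ∀ v : HeightOneSpectrum (𝓞 K), (Sum.inr v : Place K) ∉ finSupport T' →
      W.kummerSelmerStructure ((p ^ 1 : ℕ) : ℤ) (Sum.inr v) =
        unramifiedSubgroup (GaloisRep.toLocal v (W.torsionGaloisModule ((p ^ 1 : ℕ) : ℤ))) 1 := by
    intro v hv
    have h := (kummerStrict_isUnramifiedOutside W p 1 (∅ : Finset (Place K)) (finSupport T') (Finset.empty_subset _)
      hinfT hpT hbadT).2 v hv
    rwa [kummerStrict_of_not_mem W (p ^ 1) ∅ (Finset.notMem_empty _)] at h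
  -- off `T'` the base structure is the Kummer structure
  have h𝓑out : ∀ v : HeightOneSpectrum (𝓞 K), (Sum.inr v : Place K) ∉ finSupport T' →
      𝓑 (Sum.inr v) = W.kummerSelmerStructure ((p ^ 1 : ℕ) : ℤ) (Sum.inr v) := fun v hv ↦
    h𝓑K _ fun u hu h ↦ hv ((inr_mem_finSupport_iff T' v).mpr (by rw [Sum.inr_injective h]; exact hUT' u hu))
  have hw₀out : ∀ v : HeightOneSpectrum (𝓞 K), (Sum.inr v : Place K) ∉ finSupport T' → (Sum.inr v : Place K) ≠ Sum.inr w₀ :=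
    fun v hv h ↦ hv ((inr_mem_finSupport_iff T' v).mpr (by rw [Sum.inr_injective h]; exact hwT'))
  have hunrF : 𝓕.IsUnramifiedOutside (finSupport T') := by
    refine ⟨hinfT, fun v hv ↦ ?_⟩
    rw [h𝓕, Function.update_of_ne (hw₀out v hv), h𝓑out v hv]
    exact hKunr v hv
  have hunrG : 𝓖.IsUnramifiedOutside (finSupport T') := by
    refine ⟨hinfT, fun v hv ↦ ?_⟩
    rw [h𝓖, Function.update_of_ne (hw₀out v hv), h𝓑out v hv]
    exact hKunr v hv
  have heq : ∀ v : Place K, v ≠ Sum.inr w₀ → 𝓕 v = 𝓖 v := fun v hv ↦ by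
    rw [h𝓕, h𝓖, Function.update_of_ne hv, Function.update_of_ne hv]
  have hstrict : 𝓕 (Sum.inr w₀) = ⊥ := by rw [h𝓕, Function.update_self]
  have hrelax : 𝓖 (Sum.inr w₀) = ⊤ := by rw [h𝓖, Function.update_self]
  -- finiteness of the strict group (inside the Kummer group relaxed at `w₀` and `U`)
  set S'' : Finset (Place K) := insert (Sum.inr w₀ : Place K) (U.image Sum.inr) with hS''
  have hfin : Finite 𝓕.selmerGroup := by
    have hle : 𝓕.selmerGroup ≤ (kummerRelaxed W (p ^ 1) S'').selmerGroup := fun x hx ↦ by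
      rw [SelmerStructure.mem_selmerGroup_iff] at hx ⊢
      intro v
      by_cases hv : v ∈ S''
      · rw [kummerRelaxed_of_mem W (p ^ 1) S'' hv]; exact AddSubgroup.mem_top _
      · rw [kummerRelaxed_of_not_mem W (p ^ 1) S'' hv]
        have hv0 : v ≠ Sum.inr w₀ := fun h ↦ hv (h ▸ Finset.mem_insert_self _ _)
        have hvU : ∀ u ∈ U, v ≠ Sum.inr u := fun u hu h ↦
          hv (Finset.mem_insert_of_mem (Finset.mem_image.mpr ⟨u, hu, h.symm⟩))
        have h := hx v
        rwa [h𝓕, Function.update_of_ne hv0, h𝓑K v hvU] at h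
    haveI : Finite (kummerRelaxed W (p ^ 1) S'').selmerGroup := by
      rw [selmerGroup_kummerRelaxed]
      exact SelmerLevelBound.finite_kummerOutside W (p ^ 1) S''
    exact Finite.of_injective (AddSubgroup.inclusion hle) (AddSubgroup.inclusion_injective hle)
  -- the Lagrangian property off `w₀`
  have hmax : ∀ v : Place K, v ≠ Sum.inr w₀ →
      annRight (invWeilPairing W (p ^ 1) e hμ hadd₁ hadd₂ hgal inv v) (𝓕 v) = 𝓕 v := fun v hv ↦ by
    rw [h𝓕, Function.update_of_ne hv]
    by_cases hvU : ∃ u ∈ U, v = Sum.inr u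
    · obtain ⟨u, hu, rfl⟩ := hvU
      exact h𝓑lag u hu
    · push Not at hvU
      rw [h𝓑K v hvU]
      exact annRight_kummer_eq_of_odd W (p ^ 1) e hμ hadd₁ hadd₂ hgal halt hnondeg inv hp1 hodd hperf v
  exact relIndex_sq_eq_of_lagrangian W (p ^ 1) e hμ hadd₁ hadd₂ hgal hnondeg inv hperf hsum hcompl T' hS hunrF hunrG
    ⟨w₀, hwT'⟩ heq hstrict hrelax hfin hmax

end Jump

end Summit.BirchSwinnertonDyer.BirchSwinnertonDyer.Theorems.AdditiveKoly.LagrangianSwitchAtP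

end
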